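/-
Copyright (c) 2026 the pub-hodgecm-mathlib formalisation cell (harness21).  Prover seat hodgecm-mathlib-K2E4-p23 (g2), Track B ∕ K2-LIT, h413 =
`stmt-HodgeConjecture-24833`, ENGINE E1, 5Res campaign «ENDGAME BY FAMILIES», RUNG 1, deal (273)(iii) of K2E1-plan (g7), plan (P1): the GENERIC block package — a family isometry
`Uiso` into a product model yields EXACTLY the per-block items `V b ∕ hV ∕ hU` of ★ p860902 `residual_invariants_finiteDimensional_letterFree_of_blocks`.  Mathlib + ★ modelMap + ★ D4′b-2.
-/
import Summits.HodgeConjecture.HodgeConjecture.Theorems.K2E1SymbolActionThroughModelMap     -- ★ p860609 (this seat): `map_mem_orthogonal_of_adjoint` (+ ★ p860498 modelMap, ★ P3a)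
import HarnessLib

/-!
# K2·E1 — `K2E1ResidualBlockPackageOfModelMap`: THE GENERIC BLOCK PACKAGE — FROM A FAMILY ISOMETRY INTO A PRODUCT MODEL TO THE PER-BLOCK ITEMS `V ∕ hV ∕ hU` OF ★ p860902 §3
# (deal (273)(iii), plan (P1); serves the off-dual package (K2E4-p14) and the self-dual package (this seat) alike)

Track B ∕ K2-LIT, crux h413 = `stmt-HodgeConjecture-24833`, route of record `HCCMUnconditional`; cell `hodgecm-mathlib`, squad K2, ENGINE E1.  Prover seat `hodgecm-mathlib-K2E4-p23` (g2).
THEOREMS ONLY (no `def`, no `instance`, no notation, no named-fact hypothesis, no `sorry`); lane `--supports stmt-HodgeConjecture-24833 --as helper` (count-neutral).  Abstract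
Hilbert-space file.  CLOSES NO SOCKET.

SETTING.  `H` complete; a family `x : ι → H` with closed span `Θ`; a product model `M₁ × M₂` (`WithLp 2`; E1: atoms × line) and a linear isometry `Uiso : Θ →ₗᵢ WithLp 2 (M₁ × M₂)` (★ D4′c: OD ★ p860754,
SD ★ p860865); the GLOBAL model map `U = Uiso ∘L P_Θ` (★ p860498) and its PLAIN-PRODUCT form **`V := (WithLp.linearEquiv 2 ℂ (M₁ × M₂)) ∘ₗ U : H →ₗ[ℂ] M₁ × M₂`** (K2E4-p14's currency in ★
`hatoms_of_noLineMass` ∕ ★ p860902 §3); the C7 block `G = closure span gen` with the BLOCK-DOMAIN letter **`hBD : G ≤ Θ`** (finding (BD) of the 14:18Z census: C⁰- vs C²-profile classes);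
a Hecke operator `T` with `T(G) ⊆ G`, `T†(G) ⊆ G` and the ALL-OF-`H` intertwining `hUall : (ofLp (U (T u))).2 = F ((ofLp (U u)).2)` ((y2)∕(y1-c) shape, ★ `snd_modelMap_map_eq`).
* §1 `starProjection_map_comm` (`P_G (T v) = T (P_G v)` from `T(G) ⊆ G`, `T†(G) ⊆ G`), `linearEquiv_apply_eq_zero_iff`.
* §2 **`blockPackage_hV`** — `V` is injective on `G` (isometry on `Θ ⊇ G`): ★ p860902 §3's `hV`.
* §3 **`blockPackage_hU`** — for ALL `v`: `((V ∘ₗ P_G) (T v)).2 = F (((V ∘ₗ P_G) v).2)`: ★ p860902 §3's `hU` shape (there `F = (φ • ·)`, restricted to `V_P`).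
HONEST LABEL: HC_CM is proved only modulo the 7 printed citations (2 remaining named inputs: hLiu418 = `stmt-HodgeConjecture-24832`, h413 = `stmt-HodgeConjecture-24833`) until rung 0
closes; this file asserts no named fact and closes no socket; count-neutral.

## References
* [ReedSimonI1980] M. Reed, B. Simon, *Methods of Modern Mathematical Physics I* (1980), Thm. II.3, Thm. I.7.
* [MoeglinWaldspurger1995] C. Mœglin, J.-L. Waldspurger, *Spectral decomposition and Eisenstein series* (1995), II.2.4, VI.2.
-/

set_option autoImplicit false
-- the mandated namespace repeats the single-problem summit's segment (`HodgeConjecture.HodgeConjecture`)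
set_option linter.dupNamespace false

noncomputable section

open Submodule
open scoped InnerProductSpace ComplexConjugate
open Summit.HodgeConjecture.HodgeConjecture.Cruxes.H413.K2E1PlancherelIsometryOfForm (mem_topologicalClosure_span)
open Summit.HodgeConjecture.HodgeConjecture.Cruxes.H413.K2E1PlancherelModelMapOfIsometry
open Summit.HodgeConjecture.HodgeConjecture.Cruxes.H413.K2E1SymbolActionThroughModelMap (map_mem_orthogonal_of_adjoint)

namespace Summit.HodgeConjecture.HodgeConjecture.Cruxes.H413.K2E1ResidualBlockPackageOfModelMap

variable {H : Type*} [NormedAddCommGroup H] [InnerProductSpace ℂ H] [CompleteSpace H]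
  {M₁ M₂ : Type*} [NormedAddCommGroup M₁] [InnerProductSpace ℂ M₁] [NormedAddCommGroup M₂] [InnerProductSpace ℂ M₂] {ι : Type*}

/-! ## §1 Two generic facts -/

omit [CompleteSpace H] in
/-- **`P_G` COMMUTES WITH `T` WHEN `T(G) ⊆ G` AND `T†(G) ⊆ G`**: `P_G (T v) = T (P_G v)`. [cite: ReedSimonI1980, Thm. II.3] -/
theorem starProjection_map_comm [CompleteSpace H] (G : Submodule ℂ H) [G.HasOrthogonalProjection] (T : H →L[ℂ] H)
    (hTG : ∀ v ∈ G, T v ∈ G) (hTadjG : ∀ v ∈ G, ContinuousLinearMap.adjoint T v ∈ G) (v : H) :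
    G.starProjection (T v) = T (G.starProjection v) := by
  have hsplit : T v = T (G.starProjection v) + T (v - G.starProjection v) := by rw [← map_add, add_sub_cancel]
  have hperp : T (v - G.starProjection v) ∈ Gᗮ := map_mem_orthogonal_of_adjoint G T hTadjG (G.sub_starProjection_mem_orthogonal v)
  rw [hsplit, map_add, (Submodule.starProjection_apply_eq_zero_iff G).2 hperp, add_zero,
    Submodule.starProjection_eq_self_iff.2 (hTG _ (G.starProjection_apply_mem v))]

omit [CompleteSpace H] in
/-- `(WithLp.linearEquiv) m = 0 ↔ m = 0`. [folklore] -/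
theorem linearEquiv_apply_eq_zero_iff (m : WithLp 2 (M₁ × M₂)) : (WithLp.linearEquiv 2 ℂ (M₁ × M₂)) m = 0 ↔ m = 0 :=
  (WithLp.linearEquiv 2 ℂ (M₁ × M₂)).map_eq_zero_iff

/-! ## §2 `hV`: the plain-product model map is injective on the block -/

/-- **`hV` OF ★ p860902 §3**: `V := linearEquiv ∘ₗ (Uiso ∘L P_Θ)` vanishes at `y ∈ G ⊆ Θ` only if `y = 0` (`U y = Uiso y`, ★ `modelMap_apply_of_mem`; isometries are injective).
[cite: ReedSimonI1980, Thm. I.7] -/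
theorem blockPackage_hV (x : ι → H) (Uiso : ↥(span ℂ (Set.range x)).topologicalClosure →ₗᵢ[ℂ] WithLp 2 (M₁ × M₂))
    (gen : Set H) (hBD : (span ℂ gen).topologicalClosure ≤ (span ℂ (Set.range x)).topologicalClosure) :
    haveI := completeSpace_topologicalClosure_span x
    ∀ y ∈ (span ℂ gen).topologicalClosure,
      ((WithLp.linearEquiv 2 ℂ (M₁ × M₂)).toLinearMap ∘ₗ
        (Uiso.toContinuousLinearMap.comp (span ℂ (Set.range x)).topologicalClosure.orthogonalProjectionOnto).toLinearMap) y = 0 → y = 0 := by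
  haveI := completeSpace_topologicalClosure_span x
  intro y hy h0
  have hyΘ : y ∈ (span ℂ (Set.range x)).topologicalClosure := hBD hy
  rw [LinearMap.comp_apply, LinearEquiv.coe_toLinearMap, linearEquiv_apply_eq_zero_iff, ContinuousLinearMap.coe_coe,
    modelMap_apply_of_mem x Uiso ⟨y, hyΘ⟩] at h0
  have hn : ‖(⟨y, hyΘ⟩ : ↥(span ℂ (Set.range x)).topologicalClosure)‖ = 0 := by rw [← Uiso.norm_map, h0, norm_zero]
  have := norm_eq_zero.1 hn
  exact congrArg Subtype.val this

/-! ## §3 `hU`: the intertwining in ★ p860902 §3's shape, for all `v` -/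

/-- **`hU` OF ★ p860902 §3 FROM THE ALL-OF-`H` INTERTWINING**: with `T(G) ⊆ G`, `T†(G) ⊆ G` and `(ofLp (U (T u))).2 = F ((ofLp (U u)).2)` for all `u` ((y2)∕(y1-c) shape), for ALL `v`:
`((V ∘ₗ P_G) (T v)).2 = F (((V ∘ₗ P_G) v).2)` — in particular on `V_P`, with `F = (φ • ·)`. [cite: MoeglinWaldspurger1995, II.2.4, VI.2] -/
theorem blockPackage_hU (x : ι → H) (Uiso : ↥(span ℂ (Set.range x)).topologicalClosure →ₗᵢ[ℂ] WithLp 2 (M₁ × M₂))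
    (gen : Set H) (T : H →L[ℂ] H)
    (hTG : ∀ v ∈ (span ℂ gen).topologicalClosure, T v ∈ (span ℂ gen).topologicalClosure)
    (hTadjG : ∀ v ∈ (span ℂ gen).topologicalClosure, ContinuousLinearMap.adjoint T v ∈ (span ℂ gen).topologicalClosure)
    (F : M₂ → M₂)
    (hUall : haveI := completeSpace_topologicalClosure_span x
      ∀ u : H, (WithLp.ofLp ((Uiso.toContinuousLinearMap.comp (span ℂ (Set.range x)).topologicalClosure.orthogonalProjectionOnto) (T u))).2 =
        F (WithLp.ofLp ((Uiso.toContinuousLinearMap.comp (span ℂ (Set.range x)).topologicalClosure.orthogonalProjectionOnto) u)).2)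
    (v : H) :
    haveI := completeSpace_topologicalClosure_span x
    ((((WithLp.linearEquiv 2 ℂ (M₁ × M₂)).toLinearMap ∘ₗ
        (Uiso.toContinuousLinearMap.comp (span ℂ (Set.range x)).topologicalClosure.orthogonalProjectionOnto).toLinearMap) ∘ₗ
        (((span ℂ gen).topologicalClosure.starProjection : H →L[ℂ] H).toLinearMap)) (T v)).2 =
      F ((((WithLp.linearEquiv 2 ℂ (M₁ × M₂)).toLinearMap ∘ₗ
        (Uiso.toContinuousLinearMap.comp (span ℂ (Set.range x)).topologicalClosure.orthogonalProjectionOnto).toLinearMap) ∘ₗ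
        (((span ℂ gen).topologicalClosure.starProjection : H →L[ℂ] H).toLinearMap)) v).2 := by
  haveI := completeSpace_topologicalClosure_span x
  have hcomm := starProjection_map_comm (span ℂ gen).topologicalClosure T hTG hTadjG v
  change (WithLp.ofLp ((Uiso.toContinuousLinearMap.comp (span ℂ (Set.range x)).topologicalClosure.orthogonalProjectionOnto)
      ((span ℂ gen).topologicalClosure.starProjection (T v)))).2 =
    F (WithLp.ofLp ((Uiso.toContinuousLinearMap.comp (span ℂ (Set.range x)).topologicalClosure.orthogonalProjectionOnto)
      ((span ℂ gen).topologicalClosure.starProjection v))).2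
  rw [hcomm]
  exact hUall _

end Summit.HodgeConjecture.HodgeConjecture.Cruxes.H413.K2E1ResidualBlockPackageOfModelMap

end
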